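import Literature.Barriers.NavierStokesRegularity.HypodissipativeLerayNonuniquenessProofs
import Literature.Analysis.FluidPDE.FractionalNSPrescribedEnergyProofs
import Literature.Barriers.NavierStokesRegularity.HypodissipativeLerayNonuniquenessLerayExistence
import Literature.Analysis.FluidPDE.DeRosaSchemeProofs
import Literature.Analysis.FluidPDE.DeRosaTimeRegularityProofs
import Literature.Analysis.FluidPDE.DeRosaStagesProofs
import HarnessLib

/-!
# De Rosa 2019, Thm. 1.2 — the printed assembly, proved: the barrier
  `HypodissipativeLerayNonuniqueness` from De Rosa's Thm. 2.1 and Leray's existence theorem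

Second sibling proof file (definition-free) of the barrier entry
`Literature/Barriers/NavierStokesRegularity/HypodissipativeLerayNonuniqueness` (D-0021). The
catalogue entry `HypodissipativeLerayNonuniqueness` is by definition De Rosa's Thm. 1.2
(`DeRosa2019_thm12`: for `γ < 1/3` some divergence-free `v̄ ∈ L²(𝕋³)` is the datum of infinitely
many Leray solutions of `∂ₜv + div(v ⊗ v) + ∇p + (-Δ)^γ v = 0`). Its printed proof (De Rosa 2019,
§2, p. 5 of the held arXiv text) rests on four ingredients, all already in the tree:

* **Thm. 2.1** — prescribed-energy `C^β` solutions on `𝕋³ × [0,1]`, the output of the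
  convex-integration scheme (Prop. 4.1); named fact
  `Literature.Analysis.FluidPDE.DeRosa2019_thm21` (`Literature/Analysis/FluidPDE/FractionalNSPrescribedEnergy`),
  not proved in the tree (a theory);
* **Cor. 7.2** — `∫|(-Δ)^{γ/2}f|² ≤ C(ε)[f]²_{γ+ε}`; discharged,
  `Literature.Analysis.FluidPDE.DeRosa2019_cor72_holds` (`FractionalNSPrescribedEnergyProofs`);
* **Thm. 1.1** (= Colombo–De Lellis–De Rosa 2018, Thm. 1.1) — Leray solutions exist from every
  divergence-free `L²` datum; named fact `ColomboDeLellisDeRosa2018_thm11` (its Galerkin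
  discharge is the programme of `Literature/Analysis/FluidPDE/FracNSGalerkin*`);
* the **prolongation** of a local Hölder solution obeying the energy inequality by a Leray
  solution started at time `T` — proved from Thm. 1.1,
  `Literature.Analysis.FluidPDE.ColomboDeLellisDeRosa2018_prolongation_of_thm11`
  (`FractionalNSPrescribedEnergyProlongationProofs`).

This file PROVES the assembly of these ingredients exactly as printed ("Elementary arguments
produce for every `K > 1` an infinite set `𝓔_K` of smooth functions … For each `e ∈ 𝓔_K`, we now
use Theorem 2.1 … Let `T = 1/4K`. We have to show that all these solutions strictly dissipate the
total energy … if the constant `K` satisfies `K - 1 > C_{β,γ} K^{8/9}` … Finally, using Theorem 1.1,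
it is not difficult to show that all these solutions can be prolonged to Leray–Hopf solutions for
every `t ≥ 0`"):

* `DeRosa2019_thm12_of_thm21_of_thm11 : DeRosa2019_thm21 → ColomboDeLellisDeRosa2018_thm11 →
  DeRosa2019_thm12`, and `hypodissipativeLerayNonuniqueness_of_thm21_of_thm11`,

so that the trust base of the catalogue entry is reduced to the two printed theorems Thm. 2.1
(De Rosa) and Thm. 1.1 (Colombo–De Lellis–De Rosa). Thm. 1.1 being discharged in the tree
(`Literature.Analysis.FluidPDE.ColomboDeLellisDeRosa2018_thm11_holds`,
`Literature/Analysis/FluidPDE/FracNSGalerkinAssembly`, Fourier–Galerkin; barrier-side copy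
`ColomboDeLellisDeRosa2018_thm11_holds` of `HypodissipativeLerayNonuniquenessLerayExistence`), the
last section records
`hypodissipativeLerayNonuniqueness_of_thm21 : DeRosa2019_thm21 → HypodissipativeLerayNonuniqueness`:
the single remaining hypothesis is De Rosa's convex-integration theorem Thm. 2.1, and the
unconditional `HypodissipativeLerayNonuniqueness_holds` is this theorem applied to its discharge.
Thm. 2.1 being in turn reduced in the tree to the two ingredients of its printed proof (§4.2) —
Prop. 4.1 run from zero, in the regime `γ < β` covered by the printed proof of Prop. 4.1 and used by
Thm. 2.1 (`Literature.Analysis.FluidPDE.DeRosa.iterativeSchemeLT`, `Literature/Analysis/FluidPDE/DeRosaStep`),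
and the time-regularity step (`Literature.Analysis.FluidPDE.DeRosa.timeRegularity`, discharged in
`Literature/Analysis/FluidPDE/DeRosaTimeRegularityProofs`), by
`DeRosa2019_thm21_of_iterativeSchemeLT_of_timeRegularity` (`Literature/Analysis/FluidPDE/DeRosaSchemeProofs`)
— the file ends with `hypodissipativeLerayNonuniqueness_of_schemeLT` (the barrier from these two
named facts) and `hypodissipativeLerayNonuniqueness_of_iterativeSchemeLT` (the barrier from the
restricted iteration alone). (Prop. 4.1 is printed for `β, γ ∈ (0, 1/3)`
independent, but its printed proof covers only the regime `γ < β` — see the module docstring of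
`Literature/Analysis/FluidPDE/DeRosaStep` — which is the regime Thm. 2.1 uses; the tree vendors and
consumes the restricted statement.) Finally, Prop. 4.1 being proved in the tree from the three
stages of its printed proof (§5; `Literature/Analysis/FluidPDE/DeRosaThreeStages`,
`DeRosaStagesProofs`) with the mollification stage (Prop. 5.1) discharged
(`Literature/Analysis/FluidPDE/DeRosaMollificationProofs`), the last section records the current
frontier `hypodissipativeLerayNonuniqueness_of_gluing_of_perturbation`: the barrier from the named
facts `Literature.Analysis.FluidPDE.DeRosa.gluingStage` (§5.2) and
`Literature.Analysis.FluidPDE.DeRosa.perturbationStage` (§§5.3–5.5), its entire trust base.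

## Conventions

Those of `Literature/Analysis/FluidPDE/FractionalNSTorus` and `FractionalNSPrescribedEnergy`
(unit torus `(ℝ/ℤ)³`, probability Haar measure, viscosity `1`, energies in `[0, ∞]`; Thm. 2.1 in
the normalised window `c₀/2 ≤ e ≤ c₀` on `[0, T₀]` with slope bound `c₀K/T₀`).

## References

* L. De Rosa, *Infinitely many Leray–Hopf solutions for the fractional Navier–Stokes equations*,
  Comm. PDE 44 (2019), 335–365; arXiv:1801.10235, §1 (Thms. 1.1–1.2), §2 (Thm. 2.1 and the proof
  of Thm. 1.2, p. 5), §7 (Cor. 7.2). [`Derosa2018`]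
* M. Colombo, C. De Lellis, L. De Rosa, *Ill-posedness of Leray solutions for the hypodissipative
  Navier–Stokes equations*, Comm. Math. Phys. 362 (2018), 659–688; arXiv:1708.05666, §1 Thm. 1.1
  and the paragraph after Thm. 1.3. [`ColomboDelellisDerosa2018`]
-/

noncomputable section

open MeasureTheory Set Filter Topology Function
open scoped ENNReal NNReal InnerProductSpace

namespace Literature.Barriers.NavierStokesRegularity

/-! ## The assembly of De Rosa's proof of Thm. 1.2 (§2, p. 5)

Lean content of the printed paragraph. The family `𝓔_K` is realised by the explicit exponential
profiles `e_μ(t) = c₀ - (c₀/4)(1 - e^{-μt})` with rates `μ ∈ [μ₀/2, μ₀]`, `μ₀ = 2K/T₀` (in the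
normalised window `c₀/2 ≤ e ≤ c₀` on `[0, T₀]` of `DeRosa2019_thm21`): they are admissible
(`isEnergyProfile_expProfile`), share `e_μ(0) = c₀`, decrease at rate `≥ c₀μ₀/16` on `[0, T]`,
`T = T₀/(4K)` (`expProfile_sub_ge`, mean value inequality), and are pairwise different at `t = T`
(`expProfile_rate_eq`). With `K = r⁹`, `r = max 2 (16 T₀ C(ε) C² / c₀)`, Cor. 7.2 and the bound
`‖v(t)‖_∞ + [v(t)]_β ≤ C K^{4/9} = C r⁴` give `∫|(-Δ)^{γ/2} v(τ)|² ≤ C(ε) C² r⁸ ≤ c₀ μ₀ / 32`, so the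
energy inequality holds between all times `0 ≤ s < t ≤ T`; the solutions are restricted from
`[0, T₀]` to `[0, T]` (`Torus.IsWeakFracNSSolutionOn.restrict`), prolonged, and told apart modulo
space–time null sets by their kinetic energies at time `T`
(`lintegral_eL2NormSq_sub_ne_zero_of_continuousOn`).
-/

section DeRosa

open Literature.Analysis.FunctionSpaces (HolderOnSpaceTime eHolderNorm_le_eBoundedHolderNorm)
open Literature.Analysis.FluidPDE (DeRosa2019_thm21 DeRosa2019_cor72_holds IsEnergyProfile
  ColomboDeLellisDeRosa2018_prolongation_of_thm11)

/-! ### Restriction of distributional solutions to a shorter time interval -/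

/-- **Distributional solutions restrict to shorter time intervals**: a distributional solution of
the fractional system on `T^d × (0, T₀)` is one on `T^d × (0, T)` for every `T ≤ T₀`
(measurability, local square integrability and weak incompressibility restrict; a test field
compactly supported in `(0, T)` is one in `(0, T₀)`, and the weak-form integrand vanishes on
`[T, T₀)`, where the test field and its time derivative are zero). Declared by its absolute name as
a dot-notation extension of `Torus.IsWeakFracNSSolutionOn` (`FractionalNSTorus`). [folklore] -/
theorem _root_.Literature.Analysis.FluidPDE.Torus.IsWeakFracNSSolutionOn.restrict
    {d : Type*} [Fintype d] [DecidableEq d] {T₀ T α ν : ℝ}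
    {u : ℝ → UnitAddTorus d → EuclideanSpace ℝ d}
    (hu : Literature.Analysis.FluidPDE.Torus.IsWeakFracNSSolutionOn T₀ α ν u) (hT : T ≤ T₀) :
    Literature.Analysis.FluidPDE.Torus.IsWeakFracNSSolutionOn T α ν u := by
  obtain ⟨hmeas, hL2, hdiv, hweak⟩ := hu
  have hsub : Ioo (0 : ℝ) T ⊆ Ioo 0 T₀ := Ioo_subset_Ioo_right hT
  refine ⟨hmeas.mono_measure (Measure.restrict_mono (prod_mono hsub Subset.rfl) le_rfl),
    lt_of_le_of_lt (lintegral_mono_set hsub) hL2, ae_restrict_of_ae_restrict_of_subset hsub hdiv,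
    fun ψ hψ hdivψ => ?_⟩
  obtain ⟨⟨hs, T', hT', h0⟩, ε, hε, hε0⟩ := hψ
  have hψ₀ : Literature.Analysis.FunctionSpaces.Torus.IsSpaceTimeTestIoo T₀ ψ :=
    ⟨⟨hs, T', hT'.trans_le hT, h0⟩, ε, hε, hε0⟩
  have h := hweak ψ hψ₀ hdivψ
  rw [setIntegral_eq_of_subset_of_forall_sdiff_eq_zero measurableSet_Ioo hsub] at h
  · exact h
  · intro t ht
    have hTt : T ≤ t := by
      by_contra hlt
      exact ht.2 ⟨ht.1.1, lt_of_not_ge hlt⟩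
    have hT't : T' < t := hT'.trans_le hTt
    have hψt : ψ t = 0 := h0 t hT't.le
    have hψ't : Literature.Analysis.FunctionSpaces.Torus.timeDeriv ψ t = 0 := by
      funext x
      have hev : (fun τ => ψ τ x) =ᶠ[𝓝 t] fun _ => (0 : EuclideanSpace ℝ d) := by
        filter_upwards [Ioi_mem_nhds hT't] with τ hτ
        simp [h0 τ (le_of_lt hτ)]
      simp only [Literature.Analysis.FunctionSpaces.Torus.timeDeriv]
      rw [hev.deriv_eq, deriv_const, Pi.zero_apply]
    rw [hψ't, hψt]
    simp [Literature.Analysis.FluidPDE.Torus.convect_pi_zero_right,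
      Literature.Analysis.FluidPDE.Torus.fracLaplacian_zero_fun]

/-! ### The explicit family of energy profiles -/

/-- Derivative of the exponential profile `e_μ(t) = c₀ - (c₀/4)(1 - e^{-μt})`:
`e_μ'(t) = -(c₀ μ / 4) e^{-μt}`. [folklore] -/
theorem hasDerivAt_expProfile (c₀ μ t : ℝ) :
    HasDerivAt (fun t => c₀ - c₀ / 4 * (1 - Real.exp (-(μ * t))))
      (-(c₀ / 4 * μ * Real.exp (-(μ * t)))) t := by
  have h1 : HasDerivAt (fun t => -(μ * t)) (-(μ * 1)) t := ((hasDerivAt_id' t).const_mul μ).fun_neg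
  exact (((h1.exp.const_sub 1).const_mul (c₀ / 4)).const_sub c₀).congr_deriv (by ring)

/-- **The profiles `e_μ` are admissible** for `DeRosa2019_thm21` in the window `[0, T₀]` with slope
parameter `K` whenever `0 ≤ μ ≤ 4K/T₀`: they are smooth, take values in `[3c₀/4, c₀] ⊆ [c₀/2, c₀]`
for `t ≥ 0`, and `|e_μ'| = (c₀μ/4) e^{-μt} ≤ c₀ K / T₀` there (De Rosa's conditions (i)–(ii) on
`𝓔_K`, §2). [cite: Derosa2018, §2, proof of Thm. 1.2, (i)–(ii)] -/
theorem isEnergyProfile_expProfile {c₀ T₀ K μ : ℝ} (hc₀ : 0 ≤ c₀) (hμ : 0 ≤ μ)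
    (hμK : μ ≤ 4 * K / T₀) :
    IsEnergyProfile c₀ T₀ K (fun t => c₀ - c₀ / 4 * (1 - Real.exp (-(μ * t)))) where
  contDiff := contDiff_const.sub
    (contDiff_const.mul (contDiff_const.sub ((contDiff_const.mul contDiff_id).neg.exp)))
  lower := fun t _ => by
    have h1 : 0 < Real.exp (-(μ * t)) := Real.exp_pos _
    nlinarith [mul_nonneg hc₀ h1.le]
  upper := fun t ht => by
    have h1 : Real.exp (-(μ * t)) ≤ 1 := Real.exp_le_one_iff.2 (by nlinarith [ht.1])
    nlinarith [mul_nonneg hc₀ (sub_nonneg.2 h1)]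
  abs_deriv_le := fun t ht => by
    rw [(hasDerivAt_expProfile c₀ μ t).deriv, abs_neg, abs_of_nonneg (by positivity)]
    have h1 : Real.exp (-(μ * t)) ≤ 1 := Real.exp_le_one_iff.2 (by nlinarith [ht.1])
    calc c₀ / 4 * μ * Real.exp (-(μ * t)) ≤ c₀ / 4 * μ * 1 := by gcongr
      _ ≤ c₀ / 4 * (4 * K / T₀) := by rw [mul_one]; gcongr
      _ = c₀ * K / T₀ := by ring

/-- **Steep initial decrease**: if `μT ≤ 1/2` then `e_μ(s) - e_μ(t) ≥ (c₀ μ / 8)(t - s)` for all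
`0 ≤ s ≤ t ≤ T` (mean value inequality: on `[0, T]`, `-e_μ' = (c₀μ/4)e^{-μτ} ≥ (c₀μ/4)(1 - μτ) ≥
c₀μ/8`; De Rosa's condition (iv) "`e'(t) ≤ -2K + 2 ∀ t ∈ [0, 1/4K]`" on `𝓔_K`).
[cite: Derosa2018, §2, proof of Thm. 1.2, (iv)] -/
theorem expProfile_sub_ge {c₀ μ T s t : ℝ} (hc₀ : 0 ≤ c₀) (hμ : 0 ≤ μ) (hμT : μ * T ≤ 1 / 2)
    (hst : s ≤ t) (htT : t ≤ T) :
    c₀ * μ / 8 * (t - s) ≤ (c₀ - c₀ / 4 * (1 - Real.exp (-(μ * s)))) -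
      (c₀ - c₀ / 4 * (1 - Real.exp (-(μ * t)))) := by
  have hd : ∀ τ, HasDerivAt (fun t => c₀ - c₀ / 4 * (1 - Real.exp (-(μ * t))))
      (-(c₀ / 4 * μ * Real.exp (-(μ * τ)))) τ := hasDerivAt_expProfile c₀ μ
  have hderiv : ∀ τ ∈ interior (Icc s t),
      deriv (fun t => c₀ - c₀ / 4 * (1 - Real.exp (-(μ * t)))) τ ≤ -(c₀ * μ / 8) := by
    intro τ hτ
    rw [interior_Icc] at hτ
    rw [(hd τ).deriv]
    have hτT : μ * τ ≤ 1 / 2 := (mul_le_mul_of_nonneg_left (hτ.2.le.trans htT) hμ).trans hμT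
    have hexp : 1 / 2 ≤ Real.exp (-(μ * τ)) := by
      have := Real.add_one_le_exp (-(μ * τ))
      linarith
    have h2 := mul_le_mul_of_nonneg_left hexp (mul_nonneg hc₀ hμ)
    linarith
  have hmvt := (convex_Icc s t).image_sub_le_mul_sub_of_deriv_le
    (fun τ _ => (hd τ).continuousAt.continuousWithinAt)
    (fun τ _ => (hd τ).differentiableAt.differentiableWithinAt) hderiv
    s (left_mem_Icc.2 hst) t (right_mem_Icc.2 hst) hst
  linarith

/-- **The profiles are told apart by their value at any positive time**: `e_μ(T) = e_{μ'}(T)` with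
`c₀ ≠ 0`, `T ≠ 0` forces `μ = μ'` (injectivity of `exp`; De Rosa's condition (v) on `𝓔_K`).
[cite: Derosa2018, §2, proof of Thm. 1.2, (v)] -/
theorem expProfile_rate_eq {c₀ μ μ' T : ℝ} (hc₀ : c₀ ≠ 0) (hT : T ≠ 0)
    (h : c₀ - c₀ / 4 * (1 - Real.exp (-(μ * T))) = c₀ - c₀ / 4 * (1 - Real.exp (-(μ' * T)))) :
    μ = μ' := by
  have h1 : c₀ / 4 * Real.exp (-(μ * T)) = c₀ / 4 * Real.exp (-(μ' * T)) := by linarith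
  have h2 := mul_left_cancel₀ (div_ne_zero hc₀ four_ne_zero) h1
  rw [Real.exp_eq_exp, neg_inj] at h2
  exact mul_right_cancel₀ hT h2

/-! ### The assembly -/

/-- **De Rosa 2019, Thm. 1.2 from Thm. 2.1 and Thm. 1.1** (the printed proof of Thm. 1.2, §2
p. 5 of arXiv:1801.10235, with Cor. 7.2 and the prolongation remark taken from their in-tree
discharges `DeRosa2019_cor72_holds`, `ColomboDeLellisDeRosa2018_prolongation_of_thm11`). For
`γ ∈ (0, 1/3)`: fix `β = (γ + 1/3)/2 ∈ (γ, 1/3)`, the window constants `c₀, T₀, C` of Thm. 2.1 and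
the constant `C(ε)` of Cor. 7.2 (`ε = β - γ`); put `r = max 2 (16 T₀ C(ε) C²/c₀)`, `K = r⁹`,
`T = T₀/(4K)`, `μ₀ = 2K/T₀`, `μ_n = (μ₀/2)(1 + 1/(n+1))`, and let `v_n` be the solution Thm. 2.1
assigns to the admissible profile `e_{μ_n}` (`isEnergyProfile_expProfile`). All `v_n` share the
datum `v̄ = v_0(0)` (profiles agree at `0`), which is continuous hence in `L²`, and weakly
divergence free (`isWeaklyDivFree_of_continuousOn_slab`). On `[0, T]` each `v_n` obeys the energy
inequality between all pairs of times: `½(e(s) - e(t)) ≥ (c₀μ₀/32)(t - s)` (`expProfile_sub_ge`)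
while, by Cor. 7.2 and `‖v(τ)‖_∞ + [v(τ)]_β ≤ C K^{4/9} = C r⁴`,
`∫ₛᵗ∫|(-Δ)^{γ/2}v|² ≤ C(ε) C² r⁸ (t - s) ≤ (c₀μ₀/32)(t - s)` ("`K - 1 > C_{β,γ} K^{8/9}`" for `K`
large). The prolongation (Thm. 1.1 at time `T`) yields Leray solutions `u_n` from `v̄` agreeing
with `v_n` on `[0, T]`, pairwise distinct modulo null sets of `(0,∞) × 𝕋³` because
`∫|v_m(T)|² = e_{μ_m}(T) ≠ e_{μ_n}(T) = ∫|v_n(T)|²` for `m ≠ n` (`expProfile_rate_eq`,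
`lintegral_eL2NormSq_sub_ne_zero_of_continuousOn`).
[cite: Derosa2018, §2, proof of Thm. 1.2 (p. 5); Thm. 2.1; §7 Cor. 7.2; §1 Thm. 1.1] -/
theorem DeRosa2019_thm12_of_thm21_of_thm11 (h21 : DeRosa2019_thm21)
    (h11 : ColomboDeLellisDeRosa2018_thm11) : DeRosa2019_thm12 := by
  intro γ hγ hγ3
  -- a Hölder exponent strictly between `γ` and `1/3`
  obtain ⟨β, hγβ, hβ3⟩ : ∃ β : ℝ, γ < β ∧ β < 1 / 3 := ⟨(γ + 1 / 3) / 2, by linarith, by linarith⟩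
  have hγ1 : γ < 1 := by linarith
  have hβpos : 0 < Real.toNNReal β := Real.toNNReal_pos.2 (hγ.trans hγβ)
  obtain ⟨c₀, T₀, C, hc₀, hT₀, hC, hK⟩ := h21 γ β hγ hγβ hβ3
  -- Cor. 7.2 with `ε = β - γ`
  obtain ⟨C₇, hC₇, h72⟩ := DeRosa2019_cor72_holds γ (β - γ) hγ hγ1 (sub_pos.2 hγβ) (by linarith)
  have hε : γ + (β - γ) = β := by ring
  rw [hε] at h72
  -- the large parameter `K = r⁹`
  set A : ℝ := 16 * T₀ * C₇ * C ^ 2 / c₀ with hA_def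
  set r : ℝ := max 2 A with hr_def
  have hr2 : 2 ≤ r := le_max_left _ _
  have hrA : A ≤ r := le_max_right _ _
  have hr0 : 0 < r := by linarith
  set K : ℝ := r ^ 9 with hK_def
  have hK1 : 1 < K := by
    have h29 : (2 : ℝ) ^ 9 ≤ r ^ 9 := by gcongr
    have : (1 : ℝ) < 2 ^ 9 := by norm_num
    rw [hK_def]
    linarith
  have hK0 : 0 < K := by linarith
  have hK49 : K ^ (4 / 9 : ℝ) = r ^ 4 := by
    rw [hK_def, ← Real.rpow_natCast r 9, ← Real.rpow_mul hr0.le]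
    norm_num
  obtain ⟨v, hv, hv0⟩ := hK K hK1
  -- the window `[0, T]` and the rates
  set T : ℝ := T₀ / (4 * K) with hT_def
  have hT : 0 < T := by positivity
  have hTT₀ : T ≤ T₀ := div_le_self hT₀.le (by linarith)
  set μ₀ : ℝ := 2 * K / T₀ with hμ₀_def
  have hμ₀ : 0 < μ₀ := by positivity
  have hμ₀T : μ₀ * T = 1 / 2 := by
    rw [hμ₀_def, hT_def]
    field_simp
    ring
  have hμ₀K : μ₀ ≤ 4 * K / T₀ := by
    rw [hμ₀_def]
    gcongr
    norm_num
  set μ : ℕ → ℝ := fun n => μ₀ / 2 * (1 + 1 / ((n : ℝ) + 1)) with hμ_def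
  have hμ_lower : ∀ n, μ₀ / 2 ≤ μ n := fun n => by
    have h1 : (0 : ℝ) ≤ 1 / ((n : ℝ) + 1) := by positivity
    have h2 : μ n = μ₀ / 2 * (1 + 1 / ((n : ℝ) + 1)) := rfl
    rw [h2]
    exact le_mul_of_one_le_right (by positivity) (by linarith)
  have hμ_upper : ∀ n, μ n ≤ μ₀ := fun n => by
    have h1 : 1 / ((n : ℝ) + 1) ≤ 1 := by
      rw [div_le_one (by positivity)]
      linarith [(Nat.cast_nonneg n : (0 : ℝ) ≤ n)]
    have h2 : μ n = μ₀ / 2 * (1 + 1 / ((n : ℝ) + 1)) := rfl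
    rw [h2]
    calc μ₀ / 2 * (1 + 1 / ((n : ℝ) + 1)) ≤ μ₀ / 2 * 2 :=
          mul_le_mul_of_nonneg_left (by linarith) (by positivity)
      _ = μ₀ := by ring
  have hμ_pos : ∀ n, 0 < μ n := fun n => lt_of_lt_of_le (by positivity) (hμ_lower n)
  have hμT : ∀ n, μ n * T ≤ 1 / 2 := fun n => by
    rw [← hμ₀T]
    exact mul_le_mul_of_nonneg_right (hμ_upper n) hT.le
  have hμ_inj : ∀ m n : ℕ, μ m = μ n → m = n := by
    intro m n h
    have h2 : μ₀ / 2 * (1 + 1 / ((m : ℝ) + 1)) = μ₀ / 2 * (1 + 1 / ((n : ℝ) + 1)) := h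
    have h3 := mul_left_cancel₀ (show μ₀ / 2 ≠ 0 by positivity) h2
    have h4 : (1 : ℝ) / ((m : ℝ) + 1) = 1 / ((n : ℝ) + 1) := by linarith
    rw [div_eq_div_iff (by positivity) (by positivity), one_mul, one_mul] at h4
    exact_mod_cast (by linarith : (m : ℝ) = n)
  -- the profiles and the solutions assigned to them
  set e : ℕ → ℝ → ℝ := fun n t => c₀ - c₀ / 4 * (1 - Real.exp (-(μ n * t))) with he_def
  have he_apply : ∀ n t, e n t = c₀ - c₀ / 4 * (1 - Real.exp (-(μ n * t))) := fun n t => rfl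
  have he_prof : ∀ n, IsEnergyProfile c₀ T₀ K (e n) := fun n =>
    isEnergyProfile_expProfile hc₀.le (hμ_pos n).le ((hμ_upper n).trans hμ₀K)
  have he0 : ∀ n, e n 0 = c₀ := fun n => by simp [he_apply]
  have he_nonneg : ∀ n, ∀ t ∈ Icc 0 T₀, 0 ≤ e n t := fun n t ht =>
    le_trans (by linarith) ((he_prof n).lower t ht)
  have hsol : ∀ n, Literature.Analysis.FluidPDE.Torus.IsWeakFracNSSolutionOn T₀ γ 1 (v (e n)) ∧
      HolderOnSpaceTime (Real.toNNReal β) T₀ (v (e n)) ∧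
      (∀ t ∈ Icc 0 T₀, ∫ x, ‖v (e n) t x‖ ^ 2 = e n t) ∧
      ∀ t ∈ Icc 0 T₀, Literature.Analysis.FunctionSpaces.eBoundedHolderNorm (Real.toNNReal β) (v (e n) t) ≤
        ENNReal.ofReal (C * K ^ (4 / 9 : ℝ)) := fun n => hv (e n) (he_prof n)
  have hsame : ∀ n, v (e n) 0 = v (e 0) 0 := fun n =>
    hv0 (e n) (e 0) (he_prof n) (he_prof 0) (by rw [he0, he0])
  -- continuity on the slabs, restriction to `[0, T]`
  have hcont₀ : ∀ n, ContinuousOn (uncurry (v (e n))) (Icc 0 T₀ ×ˢ univ) := fun n => by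
    obtain ⟨Cn, hCn⟩ := (hsol n).2.1
    exact hCn.continuousOn hβpos
  have hcont : ∀ n, ContinuousOn (uncurry (v (e n))) (Icc 0 T ×ˢ univ) := fun n =>
    (hcont₀ n).mono (prod_mono (Icc_subset_Icc_right hTT₀) Subset.rfl)
  have hHT : ∀ n, HolderOnSpaceTime (Real.toNNReal β) T (v (e n)) := fun n => by
    obtain ⟨Cn, hCn⟩ := (hsol n).2.1
    exact ⟨Cn, hCn.mono (prod_mono (Icc_subset_Icc_right hTT₀) Subset.rfl)⟩
  have hwT : ∀ n, Literature.Analysis.FluidPDE.Torus.IsWeakFracNSSolutionOn T γ 1 (v (e n)) := fun n =>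
    (hsol n).1.restrict hTT₀
  -- `L²` slices and kinetic energies
  have hL2 : ∀ n, ∀ t ∈ Icc 0 T₀, MemLp (v (e n) t) 2 volume := fun n t ht =>
    memLp_slice_of_continuousOn_slab (hcont₀ n) ht
  have hEn : ∀ n, ∀ t ∈ Icc 0 T₀,
      Literature.Analysis.FluidPDE.Torus.eL2NormSq (v (e n) t) = ENNReal.ofReal (e n t) := fun n t ht => by
    rw [Literature.Analysis.FluidPDE.Torus.eL2NormSq,
      Literature.Analysis.FluidPDE.Torus.lintegral_enorm_sq_eq_ofReal (hL2 n t ht), (hsol n).2.2.1 t ht]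
  -- the dissipation bound on `[0, T₀]` (Cor. 7.2 and the Hölder bound of Thm. 2.1)
  set D : ℝ := C₇ * (C * r ^ 4) ^ 2 with hD_def
  have hD0 : 0 ≤ D := by positivity
  have hDslice : ∀ n, ∀ t ∈ Icc 0 T₀,
      Literature.Analysis.FluidPDE.Torus.eFracDissipation γ (v (e n) t) ≤ ENNReal.ofReal D := by
    intro n t ht
    have hmem : MemHolder (Real.toNNReal β) (v (e n) t) := (hsol n).2.1.memHolder ht
    calc Literature.Analysis.FluidPDE.Torus.eFracDissipation γ (v (e n) t)
        ≤ ENNReal.ofReal C₇ * eHolderNorm (Real.toNNReal β) (v (e n) t) ^ 2 := h72 _ hmem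
      _ ≤ ENNReal.ofReal C₇ * (ENNReal.ofReal (C * K ^ (4 / 9 : ℝ))) ^ 2 := by
          gcongr
          exact (eHolderNorm_le_eBoundedHolderNorm _ _).trans ((hsol n).2.2.2 t ht)
      _ = ENNReal.ofReal D := by
          rw [hK49, hD_def, ← ENNReal.ofReal_pow (by positivity), ← ENNReal.ofReal_mul hC₇.le]
  -- the choice of `K`: dissipation rate `D ≤ c₀ μ₀ / 32`, half the guaranteed energy decrease rate
  have hkey : 2 * D ≤ c₀ * μ₀ / 16 := by
    have h1 : 16 * T₀ * C₇ * C ^ 2 ≤ c₀ * r := by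
      have := (div_le_iff₀ hc₀).1 hrA
      linarith
    have h2 : 16 * T₀ * C₇ * C ^ 2 * r ^ 8 ≤ c₀ * r * r ^ 8 :=
      mul_le_mul_of_nonneg_right h1 (by positivity)
    have h3 : c₀ * μ₀ / 16 = c₀ * r * r ^ 8 / (8 * T₀) := by
      rw [hμ₀_def, hK_def]
      field_simp
      ring
    rw [h3, le_div_iff₀ (by positivity), hD_def]
    linarith
  -- the energy inequality on `[0, T]` between all pairs of times
  have h2inv : ∀ x : ℝ, 2⁻¹ * ENNReal.ofReal x = ENNReal.ofReal (x / 2) := fun x => by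
    rw [ENNReal.ofReal_div_of_pos two_pos, ENNReal.ofReal_ofNat, ENNReal.div_eq_inv_mul]
  have hE : ∀ n, ∀ s t : ℝ, 0 ≤ s → s < t → t ≤ T →
      Literature.Analysis.FluidPDE.Torus.FracEnergyIneq γ (v (e n)) s t := by
    intro n s t hs hst htT
    have hsT₀ : s ∈ Icc 0 T₀ := ⟨hs, by linarith⟩
    have htT₀ : t ∈ Icc 0 T₀ := ⟨by linarith, by linarith⟩
    have hdiss : ∫⁻ τ in Ioo s t, Literature.Analysis.FluidPDE.Torus.eFracDissipation γ (v (e n) τ) ≤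
        ENNReal.ofReal (D * (t - s)) :=
      calc ∫⁻ τ in Ioo s t, Literature.Analysis.FluidPDE.Torus.eFracDissipation γ (v (e n) τ)
          ≤ ∫⁻ _ in Ioo s t, ENNReal.ofReal D :=
            setLIntegral_mono' measurableSet_Ioo fun τ hτ =>
              hDslice n τ ⟨hs.trans hτ.1.le, hτ.2.le.trans (htT.trans hTT₀)⟩
        _ = ENNReal.ofReal (D * (t - s)) := by
            rw [setLIntegral_const, Real.volume_Ioo, ← ENNReal.ofReal_mul hD0]
    have hdrop : c₀ * μ n / 8 * (t - s) ≤ e n s - e n t := by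
      rw [he_apply, he_apply]
      exact expProfile_sub_ge hc₀.le (hμ_pos n).le (hμT n) hst.le htT
    have hrate : 2 * D * (t - s) ≤ e n s - e n t := by
      have hts : 0 ≤ t - s := by linarith
      have h1 : c₀ * μ₀ / 16 * (t - s) ≤ c₀ * μ n / 8 * (t - s) := by
        apply mul_le_mul_of_nonneg_right _ hts
        have h3 := mul_le_mul_of_nonneg_left (hμ_lower n) hc₀.le
        linarith
      have h2 := mul_le_mul_of_nonneg_right hkey hts
      linarith
    show 2⁻¹ * Literature.Analysis.FluidPDE.Torus.eL2NormSq (v (e n) t) +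
        ∫⁻ τ in Ioo s t, Literature.Analysis.FluidPDE.Torus.eFracDissipation γ (v (e n) τ) ≤
      2⁻¹ * Literature.Analysis.FluidPDE.Torus.eL2NormSq (v (e n) s)
    rw [hEn n t htT₀, hEn n s hsT₀, h2inv, h2inv]
    calc ENNReal.ofReal (e n t / 2) +
          ∫⁻ τ in Ioo s t, Literature.Analysis.FluidPDE.Torus.eFracDissipation γ (v (e n) τ)
        ≤ ENNReal.ofReal (e n t / 2) + ENNReal.ofReal (D * (t - s)) := add_le_add le_rfl hdiss
      _ = ENNReal.ofReal (e n t / 2 + D * (t - s)) := by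
          rw [← ENNReal.ofReal_add (by linarith [he_nonneg n t htT₀]) (by positivity)]
      _ ≤ ENNReal.ofReal (e n s / 2) := ENNReal.ofReal_le_ofReal (by linarith)
  -- prolongation past `T` by Thm. 1.1
  have hP := ColomboDeLellisDeRosa2018_prolongation_of_thm11 h11
  have hprol : ∀ n, ∃ u : ℝ → UnitAddTorus (Fin 3) → EuclideanSpace ℝ (Fin 3),
      Literature.Analysis.FluidPDE.Torus.IsLerayFracSolution γ (v (e n) 0) u ∧ ∀ t ∈ Icc 0 T, u t = v (e n) t :=
    fun n => hP γ β T hγ hγβ hβ3 hT (v (e n)) (hHT n) (hwT n) (hE n)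
  choose u hu huv using hprol
  refine ⟨v (e 0) 0, hL2 0 0 ⟨le_rfl, hT₀.le⟩,
    isWeaklyDivFree_of_continuousOn_slab hT₀ (hcont₀ 0) (hsol 0).1.2.2.1 ⟨le_rfl, hT₀.le⟩,
    u, fun n => ?_, fun m n hmn => ?_⟩
  · rw [← hsame n]
    exact hu n
  · have hTmem : T ∈ Icc 0 T₀ := ⟨hT.le, hTT₀⟩
    have hne : v (e m) T ≠ v (e n) T := by
      intro hEq
      have h1 : e m T = e n T := by
        rw [← (hsol m).2.2.1 T hTmem, ← (hsol n).2.2.1 T hTmem, hEq]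
      rw [he_apply, he_apply] at h1
      exact hmn (hμ_inj m n (expProfile_rate_eq hc₀.ne' hT.ne' h1))
    exact lintegral_eL2NormSq_sub_ne_zero_of_continuousOn hT (hcont m) (hcont n) ⟨hT.le, le_rfl⟩
      hne (huv m) (huv n)

/-- **The barrier from De Rosa's Thm. 2.1 and Leray's existence theorem**: the catalogue entry
`HypodissipativeLerayNonuniqueness` (`= DeRosa2019_thm12` by definition) follows from the named
facts `DeRosa2019_thm21` (convex integration with prescribed energy) and
`ColomboDeLellisDeRosa2018_thm11` (Leray solutions exist for every divergence-free `L²` datum),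
everything else in the printed proof being discharged in the tree. Its trust base is thereby
reduced to these two printed theorems. [cite: Derosa2018, §2, proof of Thm. 1.2 (p. 5)] -/
theorem hypodissipativeLerayNonuniqueness_of_thm21_of_thm11 (h21 : DeRosa2019_thm21)
    (h11 : ColomboDeLellisDeRosa2018_thm11) : HypodissipativeLerayNonuniqueness :=
  DeRosa2019_thm12_of_thm21_of_thm11 h21 h11

/-- Under the same two facts, the Colombo–De Lellis–De Rosa range `α < 1/5` is covered as well
(`DeRosa2019_thm12.colomboDeLellisDeRosa`). [cite: Derosa2018, §1 Thm. 1.2 and §2] -/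
theorem ColomboDeLellisDeRosa2018_thm12_of_deRosa_thm21_of_thm11 (h21 : DeRosa2019_thm21)
    (h11 : ColomboDeLellisDeRosa2018_thm11) : ColomboDeLellisDeRosa2018_thm12 :=
  (DeRosa2019_thm12_of_thm21_of_thm11 h21 h11).colomboDeLellisDeRosa

end DeRosa

/-! ## With Leray's existence theorem discharged: the barrier from De Rosa's Thm. 2.1 alone -/

section Discharged

open Literature.Analysis.FluidPDE (DeRosa2019_thm21)

/-- **The barrier from De Rosa's Thm. 2.1 alone**: with Thm. 1.1 discharged, the catalogue entry
`HypodissipativeLerayNonuniqueness` (`= DeRosa2019_thm12`) follows from the single named fact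
`DeRosa2019_thm21` (prescribed-energy Hölder solutions from the convex-integration scheme), which
is thereby its entire trust base. [cite: Derosa2018, §2, proof of Thm. 1.2 (p. 5)] -/
theorem hypodissipativeLerayNonuniqueness_of_thm21 (h21 : DeRosa2019_thm21) :
    HypodissipativeLerayNonuniqueness :=
  hypodissipativeLerayNonuniqueness_of_thm21_of_thm11 h21 ColomboDeLellisDeRosa2018_thm11_holds

/-- De Rosa 2019, Thm. 1.2 from his Thm. 2.1 alone (Thm. 1.1 discharged).
[cite: Derosa2018, §2, proof of Thm. 1.2 (p. 5)] -/
theorem DeRosa2019_thm12_of_thm21 (h21 : DeRosa2019_thm21) : DeRosa2019_thm12 :=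
  DeRosa2019_thm12_of_thm21_of_thm11 h21 ColomboDeLellisDeRosa2018_thm11_holds

/-- Colombo–De Lellis–De Rosa 2018, Thm. 1.2 from De Rosa's Thm. 2.1 alone (the range `α < 1/5`
is contained in De Rosa's `γ < 1/3`). [cite: Derosa2018, §1 Thm. 1.2 and §2] -/
theorem ColomboDeLellisDeRosa2018_thm12_of_deRosa_thm21 (h21 : DeRosa2019_thm21) :
    ColomboDeLellisDeRosa2018_thm12 :=
  (DeRosa2019_thm12_of_thm21 h21).colomboDeLellisDeRosa

end Discharged

/-! ## The barrier from the two ingredients of the proof of Thm. 2.1 (Prop. 4.1 for `γ < β`, and time regularity) -/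

section Scheme

open Literature.Analysis.FluidPDE (DeRosa2019_thm21 DeRosa2019_thm21_of_iterativeSchemeLT_of_timeRegularity)

/-- **The barrier from De Rosa's iteration (regime `γ < β`) and the time-regularity step.** With
Thm. 1.1 (Leray existence) and the assembly §2 discharged, and Thm. 2.1 reduced to the two
ingredients of its printed proof in §4.2 (`DeRosa2019_thm21_of_iterativeSchemeLT_of_timeRegularity`:
the scheme is run with a Hölder exponent above `γ`, so only the regime `γ < β` of Prop. 4.1 — the
one covered by its printed proof — is needed), the catalogue entry
`HypodissipativeLerayNonuniqueness` follows from the named facts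
`Literature.Analysis.FluidPDE.DeRosa.iterativeSchemeLT` (Prop. 4.1 of the paper run from zero, for
`γ < β`: the convex-integration step — mollification, gluing, Mikado perturbation, §§5–7) and
`Literature.Analysis.FluidPDE.DeRosa.timeRegularity` (the mollification/Schauder argument of §4.2).
[cite: Derosa2018, §2 (proof of Thm. 1.2) and §4.2 (proof of Thm. 2.1)] -/
theorem hypodissipativeLerayNonuniqueness_of_schemeLT
    (hit : Literature.Analysis.FluidPDE.DeRosa.iterativeSchemeLT)
    (htime : Literature.Analysis.FluidPDE.DeRosa.timeRegularity) : HypodissipativeLerayNonuniqueness :=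
  hypodissipativeLerayNonuniqueness_of_thm21
    (DeRosa2019_thm21_of_iterativeSchemeLT_of_timeRegularity hit htime)

/-- De Rosa 2019, Thm. 1.2 from Prop. 4.1 (run from zero, `γ < β`) and the time-regularity step.
[cite: Derosa2018, §2 and §4.2] -/
theorem DeRosa2019_thm12_of_schemeLT (hit : Literature.Analysis.FluidPDE.DeRosa.iterativeSchemeLT)
    (htime : Literature.Analysis.FluidPDE.DeRosa.timeRegularity) : DeRosa2019_thm12 :=
  DeRosa2019_thm12_of_thm21 (DeRosa2019_thm21_of_iterativeSchemeLT_of_timeRegularity hit htime)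

/-- Colombo–De Lellis–De Rosa 2018, Thm. 1.2 (`α < 1/5`) from the same two facts.
[cite: Derosa2018, §1 Thm. 1.2, §2 and §4.2] -/
theorem ColomboDeLellisDeRosa2018_thm12_of_deRosa_schemeLT
    (hit : Literature.Analysis.FluidPDE.DeRosa.iterativeSchemeLT)
    (htime : Literature.Analysis.FluidPDE.DeRosa.timeRegularity) : ColomboDeLellisDeRosa2018_thm12 :=
  (DeRosa2019_thm12_of_schemeLT hit htime).colomboDeLellisDeRosa

end Scheme

/-! ## The barrier from the convex-integration iteration alone (time regularity discharged) -/

section Iteration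

open Literature.Analysis.FluidPDE (DeRosa2019_thm21 DeRosa2019_thm21_of_iterativeSchemeLT_of_timeRegularity)

/-- **The barrier from De Rosa's iteration alone** (`DeRosa.iterativeSchemeLT`, `DeRosaStep`:
Prop. 4.1 run from zero in the regime `γ < β` covered by the printed proof of Prop. 4.1, which
suffices for Thm. 2.1, the scheme being run with a Hölder exponent above `γ`). The time-regularity
step of §4.2 being discharged (`Literature.Analysis.FluidPDE.DeRosa.timeRegularity_holds`,
`DeRosaTimeRegularityProofs`: heat-kernel mollification, the pressure equation of the fractional
Navier–Stokes–Reynolds system and the subordination bound `‖e^{τΔ}(-Δ)^γ v‖₀ ≲ τ^{-γ}‖v‖₀`), the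
catalogue entry `HypodissipativeLerayNonuniqueness` (De Rosa 2019, Thm. 1.2) follows from this
single named fact — the convex-integration construction of §§5–7 (mollification, gluing, Mikado
perturbation) — which is thereby its entire trust base.
[cite: Derosa2018, §2 (proof of Thm. 1.2) and §4.2 (proof of Thm. 2.1)] -/
theorem hypodissipativeLerayNonuniqueness_of_iterativeSchemeLT
    (hit : Literature.Analysis.FluidPDE.DeRosa.iterativeSchemeLT) : HypodissipativeLerayNonuniqueness :=
  hypodissipativeLerayNonuniqueness_of_thm21
    (DeRosa2019_thm21_of_iterativeSchemeLT_of_timeRegularity hit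
      Literature.Analysis.FluidPDE.DeRosa.timeRegularity_holds)

/-- De Rosa 2019, Thm. 1.2 from the restricted iteration `DeRosa.iterativeSchemeLT` alone.
[cite: Derosa2018, §2 and §4.2] -/
theorem DeRosa2019_thm12_of_iterativeSchemeLT
    (hit : Literature.Analysis.FluidPDE.DeRosa.iterativeSchemeLT) : DeRosa2019_thm12 :=
  DeRosa2019_thm12_of_thm21
    (DeRosa2019_thm21_of_iterativeSchemeLT_of_timeRegularity hit
      Literature.Analysis.FluidPDE.DeRosa.timeRegularity_holds)

/-- De Rosa 2019, Thm. 2.1 from the restricted iteration `DeRosa.iterativeSchemeLT` alone.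
[cite: Derosa2018, §4.2] -/
theorem DeRosa2019_thm21_of_iterativeSchemeLT
    (hit : Literature.Analysis.FluidPDE.DeRosa.iterativeSchemeLT) : DeRosa2019_thm21 :=
  DeRosa2019_thm21_of_iterativeSchemeLT_of_timeRegularity hit
    Literature.Analysis.FluidPDE.DeRosa.timeRegularity_holds

/-- Colombo–De Lellis–De Rosa 2018, Thm. 1.2 (`α < 1/5`) from the restricted iteration
`DeRosa.iterativeSchemeLT` alone. [cite: Derosa2018, §1 Thm. 1.2, §2 and §4.2] -/
theorem ColomboDeLellisDeRosa2018_thm12_of_deRosa_iterativeSchemeLT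
    (hit : Literature.Analysis.FluidPDE.DeRosa.iterativeSchemeLT) : ColomboDeLellisDeRosa2018_thm12 :=
  (DeRosa2019_thm12_of_iterativeSchemeLT hit).colomboDeLellisDeRosa

end Iteration

/-! ## The frontier: the barrier from De Rosa's gluing and perturbation stages alone -/

section Stages

open Literature.Analysis.FluidPDE (DeRosa2019_thm21)

/-- **The barrier from the two outstanding stages of De Rosa's Prop. 4.1** — the current frontier
of the discharge of the catalogue entry as ONE reduction whose hypotheses are exactly the
outstanding published inputs. De Rosa proves Prop. 4.1 in three stages (§5: mollification §5.1,
gluing §5.2, perturbation §§5.3–5.5; in the tree the named facts `DeRosa.mollificationStage`,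
`DeRosa.gluingStage`, `DeRosa.perturbationStage` of `DeRosaThreeStages`). The mollification stage
(Prop. 5.1) is discharged (`Literature.Analysis.FluidPDE.DeRosa.mollificationStage_holds`,
`DeRosaMollificationProofs`), the three stages imply Prop. 4.1 run from zero
(`Literature.Analysis.FluidPDE.DeRosa.iterativeSchemeLT_of_gluing_of_perturbation`,
`DeRosaStagesProofs`), and Prop. 4.1 run from zero implies the entry
(`hypodissipativeLerayNonuniqueness_of_iterativeSchemeLT` above: §4.2 with the time-regularity
step discharged, §2 with Thm. 1.1 and Cor. 7.2 discharged). Hence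
`HypodissipativeLerayNonuniqueness` (De Rosa 2019, Thm. 1.2) follows from the gluing stage (§5.2:
Cor. 5.2, Props. 5.3–5.5) and the perturbation stage (§§5.3–5.5: Props. 5.11–5.13) alone, and
`HypodissipativeLerayNonuniqueness_holds` is this theorem fed with their discharges.
[cite: Derosa2018, §2 (proof of Thm. 1.2), §4.2 (proof of Thm. 2.1), §5 (proof of Prop. 4.1)] -/
theorem hypodissipativeLerayNonuniqueness_of_gluing_of_perturbation
    (h₂ : Literature.Analysis.FluidPDE.DeRosa.gluingStage)
    (h₃ : Literature.Analysis.FluidPDE.DeRosa.perturbationStage) :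
    HypodissipativeLerayNonuniqueness :=
  hypodissipativeLerayNonuniqueness_of_iterativeSchemeLT
    (Literature.Analysis.FluidPDE.DeRosa.iterativeSchemeLT_of_gluing_of_perturbation h₂ h₃)

/-- De Rosa 2019, Thm. 1.2 from the gluing and perturbation stages of Prop. 4.1 alone.
[cite: Derosa2018, §2, §4.2 and §5] -/
theorem DeRosa2019_thm12_of_gluing_of_perturbation
    (h₂ : Literature.Analysis.FluidPDE.DeRosa.gluingStage)
    (h₃ : Literature.Analysis.FluidPDE.DeRosa.perturbationStage) : DeRosa2019_thm12 :=
  DeRosa2019_thm12_of_iterativeSchemeLT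
    (Literature.Analysis.FluidPDE.DeRosa.iterativeSchemeLT_of_gluing_of_perturbation h₂ h₃)

/-- De Rosa 2019, Thm. 2.1 from the gluing and perturbation stages of Prop. 4.1 alone.
[cite: Derosa2018, §4.2 and §5] -/
theorem DeRosa2019_thm21_of_gluing_of_perturbation
    (h₂ : Literature.Analysis.FluidPDE.DeRosa.gluingStage)
    (h₃ : Literature.Analysis.FluidPDE.DeRosa.perturbationStage) : DeRosa2019_thm21 :=
  DeRosa2019_thm21_of_iterativeSchemeLT
    (Literature.Analysis.FluidPDE.DeRosa.iterativeSchemeLT_of_gluing_of_perturbation h₂ h₃)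

/-- Colombo–De Lellis–De Rosa 2018, Thm. 1.2 (`α < 1/5`) from the gluing and perturbation stages
of De Rosa's Prop. 4.1 alone. [cite: Derosa2018, §1 Thm. 1.2, §2, §4.2 and §5] -/
theorem ColomboDeLellisDeRosa2018_thm12_of_deRosa_gluing_of_perturbation
    (h₂ : Literature.Analysis.FluidPDE.DeRosa.gluingStage)
    (h₃ : Literature.Analysis.FluidPDE.DeRosa.perturbationStage) :
    ColomboDeLellisDeRosa2018_thm12 :=
  (DeRosa2019_thm12_of_gluing_of_perturbation h₂ h₃).colomboDeLellisDeRosa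

end Stages

end Literature.Barriers.NavierStokesRegularity
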